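/-
Copyright (c) 2026 the pub-hodgecm-mathlib formalisation cell (harness21).  Prover seat hodgecm-mathlib-LH4-p09 (g8), req620 Track A «(D-RAM) FOUR-FRAME» squad
(heir dealer LH4-plan (g13) WORD #66 (2): (T-2tok) for F0P3a-p01 (g36)'s level trunks).  2026-09-04.
-/
import Summits.HodgeConjecture.HodgeConjecture.Theorems.F0P3cDyRamLabelledTwoTokenReductions          -- (this seat) T1: reductions (`_of_ne_*`); brings K4 ★ p859791 (G1 tube heads)
import Summits.HodgeConjecture.HodgeConjecture.Theorems.F0P3cDyRamLabelledKappaGluedLocusFoot           -- ★ p859828 (this seat) K5: G1 foot heads; brings ★ p859571 `modelToken_data`, `glueRatio_modelToken_eq`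
import Summits.HodgeConjecture.HodgeConjecture.Theorems.F0P3cDyRamLabelledKappaSqTokenCells            -- ★ p859864 (this seat) K6: `sqToken_differences`, `…_G1_sep_sqToken_tube`
import HarnessLib

/-!
# (D-RAM) four-frame, STAGE 1b — (T-2tok) HEADS, glued: the TWO-TOKEN labelled κ-cells of `G1 (2ρ, 2ρ+2t′, 2ρ+2t′)` at the letters of record
# `L₁ = [D₁ M ⊆ ϖ^{ℓ₁} M]`, `L₂ = [D₂ M ⊆ ϖ^{ℓ₂} M]` — glue foot (`D₁` on its locus), tube on the `D₁` locus `n₁ = n₂ + 2t′`, tube on the `D₂` locus `n₁ = n₂ + t′`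

Helper brick for dealer LH4-plan (g13) WORD #66 (2) ∕ F0P3a-p01 (g36) 11:43Z (T-2tok): `Theorems/` only, statement-first, ★-only imports, lane
`--supports stmt-HodgeConjecture-24833 --as helper`; it PAYS NO tier-0 row (count-neutral).  ON `G1` THE TWO LOCI NEVER MEET (`t′ ≥ 1`), so every two-token cell is
`[read of the off-locus token] · (one-token on-locus cell)` by T1 `finsum_stratum_G1_sep_and_eq_of_ne_right ∕ _left`; this file evaluates the three live cases
numerically (`G2 ∕ G3` by LH4-p12 (g7)'s ★ p859787 rotations; both tokens off their loci = ★ p859717 `…_G1_sep_two_of_ne`; empty regimes = ★ p859544's any-`L` heads):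
* §1 `sqToken_read_G1_iff` — with `n₁ = n₂ + 2t′`: the `D₂` read (★ p859257 form, `s = 2t′`) is `ℓ₂ + 2ρ ≤ 2n₂`, and `D₂` is off its locus;
  `modelToken_read_G1_iff` — with `n₁ = n₂ + t′`, `n₃ = n₂`: the `D₁` read is `ℓ₁ + 2ρ + t′ ≤ n₂`, and `D₁` is off its locus.
* §2 **`finsum_kappaCount_mul_stabiliserWeight_stratum_G1_sep_levels_foot`** (glue foot `n₁ = n₂ + 2t′`, `ρ ≤ n₂ < 2ρ`; `E₁ = ℓ₁ + 2ρ + 2t′ − n₂`):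
  `= [ℓ₂ + 2ρ ≤ 2n₂] · [ℓ₁ + ρ ≤ n₂ ∧ ℓ₁ + 2ρ − n₂ ≤ n₂ − d + 1] · (ω(−1)ω(1+f₀)·[2d ≤ E₁+1], ω(−1)ω(f₀)ω(1+f₀)·[2d+2t′ ≤ E₁+1], ω(f₀)·[2d+2t′ ≤ E₁+1])ᵢ · q^{2ρ+2t′−⌈E₁∕2⌉}`
  (`f₀` any fixed glue witness at depth `E₁`, which exists iff `ℓ₁ + 2ρ − n₂ ≤ n₂ − d + 1` by the ★ bridge `exists_fixed_v_add_glueUnit_le_iff`).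
* §3 **`…_G1_sep_levels_tube_locusOne`** (tube, `n₁ = n₂ + 2t′ ≥ 2ρ + 2t′`): `D₁` vacuous (`ℓ₁ + 2ρ ≤ n₂`) ⇒ `[ℓ₂ + 2ρ ≤ 2n₂] · ★ κG1`; genuine ⇒ the same sign
  vector × `q^{2ρ+2t′−⌈E₁∕2⌉}` behind `[ℓ₁ + ρ ≤ n₂ ∧ ℓ₁ + 2ρ − n₂ ≤ n₂ − d + 1]`.
* §4 **`…_G1_sep_levels_tube_locusTwo`** (tube, `n₁ = n₂ + t′`, guard `ℓ₂ ≤ 2ρ`): `= [ℓ₁ + 2ρ + t′ ≤ n₂] · ★ κG1` (K6: `D₂` vacuous on its tube locus).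

HONEST LABEL: helper organs for HYPOTHESES (two-token trunks ★ p859769 ∕ p859848); STAGE-1b tier-0 rows T₊∕T₋∕regular and the ED. 5∕6 law stubs stay OPEN; HC_CM is
proved only modulo the 7 printed citations (2 remaining named inputs: hLiu418 = `stmt-HodgeConjecture-24832`, h413 = `stmt-HodgeConjecture-24833`) until rung 0 closes.

## References
* [Kottwitz1986BaseChangeUnits] R. E. Kottwitz, *Base change for unit elements of Hecke algebras*, Compositio Math. 60 (1986), §1 pp. 240–241 (κ-orbital integrals of units as signed lattice counts modulo the torus).
* [LanglandsShelstad1987] R. P. Langlands, D. Shelstad, *On the definition of transfer factors*, Math. Ann. 278 (1987), §3 (κ as a character).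
* [Rogawski1990] J. D. Rogawski, *Automorphic Representations of Unitary Groups in Three Variables*, Ann. of Math. Stud. 123 (1990), §4.9 Prop. 4.9.1 (a)(b) p. 55.
* [Serre1979] J.-P. Serre, *Local Fields*, GTM 67 (1979), Ch. V §3 Prop. 5, Cor. 3 (norm residue symbol; glue-unit rationality depth).
-/

set_option autoImplicit false

noncomputable section

namespace Summit.HodgeConjecture.HodgeConjecture.Cruxes.H413.F0P3cDyRamLabelledKappaTwoTokenGlued

open Matrix WithZero
open Literature.NumberTheory.Automorphic Literature.NumberTheory.Automorphic.HermitianLattice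
open Literature.NumberTheory.Automorphic.UnitaryLatticeTree Literature.NumberTheory.Automorphic.UnitaryThreeFourFrame
open Literature.NumberTheory.LocalFields.WildQuadraticDatum
open Summit.HodgeConjecture.HodgeConjecture.Cruxes.H413.F0P3cDyRamDiagonalTorusDefs
open Summit.HodgeConjecture.HodgeConjecture.Cruxes.H413.F0P3cDyRamDiagonalStrataDefs
open Summit.HodgeConjecture.HodgeConjecture.Cruxes.H413.F0P3cDyRamDiagonalKappaCountDefs
open Summit.HodgeConjecture.HodgeConjecture.Cruxes.H413.F0P3cDyRamDiagonalGluedStabiliserIndex (ne_zero_and_v_lt_one_of_v_eq_exp)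
open Summit.HodgeConjecture.HodgeConjecture.Cruxes.H413.F0P3cDyRamDiagonalKappaGluedSocket (finsum_kappaCount_mul_stabiliserWeight_hasAxis_G1)
open Summit.HodgeConjecture.HodgeConjecture.Cruxes.H413.F0P3cDyRamElementDatumParity (isoceles_of_isElementDatum)
open Summit.HodgeConjecture.HodgeConjecture.Cruxes.H413.F0P3cDyRamGlueUnitRationalityDepth (exists_fixed_v_add_glueUnit_le_iff)
open Summit.HodgeConjecture.HodgeConjecture.Cruxes.H413.F0P3cDyRamFourFrameCensusDefs
open Summit.HodgeConjecture.HodgeConjecture.Cruxes.H413.F0P3cDyRamLabelledGluedLocusCensusFoot (glueRatio_modelToken_eq modelToken_data v_glueUnit_eq)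
open Summit.HodgeConjecture.HodgeConjecture.Cruxes.H413.F0P3cDyRamLabelledKappaGluedLocus
open Summit.HodgeConjecture.HodgeConjecture.Cruxes.H413.F0P3cDyRamLabelledKappaGluedLocusFoot
open Summit.HodgeConjecture.HodgeConjecture.Cruxes.H413.F0P3cDyRamLabelledKappaSqTokenCells (sqToken_differences finsum_kappaCount_mul_stabiliserWeight_stratum_G1_sep_sqToken_tube)
open Summit.HodgeConjecture.HodgeConjecture.Cruxes.H413.F0P3cDyRamLabelledTwoTokenReductions
open scoped Valued WithZero Matrix MatrixGroups

/-! ## §1  The off-locus reads at the letters of record, numerically -/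

section Reads

variable {K : Type*} [Field K] [Valued K ℤᵐ⁰]

/-- **THE `D₂` READ ON `G1(ρ, 2t′)` WITH `n₁ = n₂ + 2t′`** (`t′ ≥ 1`; `D₂ = diag((α−1)², (β−1)², 0)`): `D₂` is OFF its glue locus (`2n₁ ≠ 2n₂ + 2t′`), and the four-part read
of ★ p859257 at `(ℓ, ρ, s = 2t′)` is `ℓ + 2ρ ≤ 2n₂` (`|(β−1)² − (α−1)²| = |ϖ|^{2n₂}` since `n₁ > n₂`). [cite: Kottwitz1986BaseChangeUnits, §1 pp. 240–241] -/
theorem sqToken_read_G1_iff {ϖ α β : K} (hϖ : Valued.v ϖ = exp (-1 : ℤ)) {n₁ n₂ t' : ℕ} (h₁ : Valued.v (β - 1) = Valued.v ϖ ^ n₁)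
    (h₂ : Valued.v (α - 1) = Valued.v ϖ ^ n₂) (hn : n₁ = n₂ + 2 * t') (ht' : 1 ≤ t') (ℓ ρ : ℕ) :
    Valued.v ((![(α - 1) * (α - 1), (β - 1) * (β - 1), 0] : Fin 3 → K) 2 - (![(α - 1) * (α - 1), (β - 1) * (β - 1), 0] : Fin 3 → K) 1) ≠
        Valued.v ((![(α - 1) * (α - 1), (β - 1) * (β - 1), 0] : Fin 3 → K) 2 - (![(α - 1) * (α - 1), (β - 1) * (β - 1), 0] : Fin 3 → K) 0) *
          Valued.v ϖ ^ (2 * t') ∧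
      ((((Valued.v ((![(α - 1) * (α - 1), (β - 1) * (β - 1), 0] : Fin 3 → K) 0) ≤ Valued.v ϖ ^ ℓ ∧
            Valued.v ((![(α - 1) * (α - 1), (β - 1) * (β - 1), 0] : Fin 3 → K) 1) ≤ Valued.v ϖ ^ ℓ ∧
            Valued.v ((![(α - 1) * (α - 1), (β - 1) * (β - 1), 0] : Fin 3 → K) 2) ≤ Valued.v ϖ ^ ℓ) ∧
          Valued.v ((![(α - 1) * (α - 1), (β - 1) * (β - 1), 0] : Fin 3 → K) 1 - (![(α - 1) * (α - 1), (β - 1) * (β - 1), 0] : Fin 3 → K) 0) ≤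
              Valued.v ϖ ^ (ℓ + ρ) ∧
          Valued.v ((![(α - 1) * (α - 1), (β - 1) * (β - 1), 0] : Fin 3 → K) 2 - (![(α - 1) * (α - 1), (β - 1) * (β - 1), 0] : Fin 3 → K) 1) ≤
              Valued.v ϖ ^ (ℓ + ρ + 2 * t') ∧
          (Valued.v ((![(α - 1) * (α - 1), (β - 1) * (β - 1), 0] : Fin 3 → K) 2 - (![(α - 1) * (α - 1), (β - 1) * (β - 1), 0] : Fin 3 → K) 1) ≤
              Valued.v ϖ ^ (ℓ + 2 * ρ + 2 * t') ∧
            Valued.v ((![(α - 1) * (α - 1), (β - 1) * (β - 1), 0] : Fin 3 → K) 2 - (![(α - 1) * (α - 1), (β - 1) * (β - 1), 0] : Fin 3 → K) 0) *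
                Valued.v ϖ ^ (2 * t') ≤ Valued.v ϖ ^ (ℓ + 2 * ρ + 2 * t')))) ↔ ℓ + 2 * ρ ≤ 2 * n₂) := by
  obtain ⟨hϖ0, hϖ1⟩ := ne_zero_and_v_lt_one_of_v_eq_exp hϖ
  have hvϖ : 0 < Valued.v ϖ := (Valuation.pos_iff _).2 hϖ0
  have hple : ∀ m n : ℕ, Valued.v ϖ ^ m ≤ Valued.v ϖ ^ n ↔ n ≤ m := fun m n => UnitaryLatticeTree.v_pow_le_v_pow_iff hϖ m n
  have hpeq : ∀ m n : ℕ, Valued.v ϖ ^ m = Valued.v ϖ ^ n ↔ m = n := fun m n =>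
    ⟨fun h => le_antisymm ((hple n m).1 h.ge) ((hple m n).1 h.le), fun h => by rw [h]⟩
  have hsq₁ : Valued.v ((β - 1) * (β - 1)) = Valued.v ϖ ^ (2 * n₁) := by rw [map_mul, h₁, ← pow_add, two_mul]
  have hsq₂ : Valued.v ((α - 1) * (α - 1)) = Valued.v ϖ ^ (2 * n₂) := by rw [map_mul, h₂, ← pow_add, two_mul]
  have hd10 : Valued.v ((β - 1) * (β - 1) - (α - 1) * (α - 1)) = Valued.v ϖ ^ (2 * n₂) := by
    rw [Valuation.map_sub_swap, Valuation.map_sub_eq_of_lt_left _ (by rw [hsq₁, hsq₂]; exact pow_lt_pow_right_of_lt_one₀ hvϖ hϖ1 (by omega)), hsq₂]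
  simp only [Matrix.cons_val_zero, Matrix.cons_val_one, Matrix.cons_val_two, Matrix.tail_cons, Matrix.head_cons, zero_sub, Valuation.map_neg, map_zero,
    zero_le, and_true, hsq₁, hsq₂, hd10, ← pow_add, hple, Ne, hpeq]
  exact ⟨by omega, ⟨fun h => by omega, fun h => ⟨⟨by omega, by omega⟩, by omega, by omega, by omega, by omega⟩⟩⟩

/-- **THE `D₁` READ ON `G1(ρ, 2t′)` WITH `n₁ = n₂ + t′`, `n₃ = n₂`** (`t′ ≥ 1`; `D₁ = diag(α−1, β−1, 0)`): `D₁` is OFF its glue locus (`n₁ ≠ n₂ + 2t′`), and the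
four-part read at `(ℓ, ρ, s = 2t′)` is `ℓ + 2ρ + t′ ≤ n₂`. [cite: Kottwitz1986BaseChangeUnits, §1 pp. 240–241] -/
theorem modelToken_read_G1_iff {ϖ α β : K} (hϖ : Valued.v ϖ = exp (-1 : ℤ)) {n₁ n₂ n₃ t' : ℕ} (h₁ : Valued.v (β - 1) = Valued.v ϖ ^ n₁)
    (h₂ : Valued.v (α - 1) = Valued.v ϖ ^ n₂) (h₃ : Valued.v (α - β) = Valued.v ϖ ^ n₃) (hn : n₁ = n₂ + t') (hn₃ : n₃ = n₂) (ht' : 1 ≤ t') (ℓ ρ : ℕ) :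
    Valued.v ((![α - 1, β - 1, 0] : Fin 3 → K) 2 - (![α - 1, β - 1, 0] : Fin 3 → K) 1) ≠
        Valued.v ((![α - 1, β - 1, 0] : Fin 3 → K) 2 - (![α - 1, β - 1, 0] : Fin 3 → K) 0) * Valued.v ϖ ^ (2 * t') ∧
      ((((Valued.v ((![α - 1, β - 1, 0] : Fin 3 → K) 0) ≤ Valued.v ϖ ^ ℓ ∧ Valued.v ((![α - 1, β - 1, 0] : Fin 3 → K) 1) ≤ Valued.v ϖ ^ ℓ ∧
            Valued.v ((![α - 1, β - 1, 0] : Fin 3 → K) 2) ≤ Valued.v ϖ ^ ℓ) ∧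
          Valued.v ((![α - 1, β - 1, 0] : Fin 3 → K) 1 - (![α - 1, β - 1, 0] : Fin 3 → K) 0) ≤ Valued.v ϖ ^ (ℓ + ρ) ∧
          Valued.v ((![α - 1, β - 1, 0] : Fin 3 → K) 2 - (![α - 1, β - 1, 0] : Fin 3 → K) 1) ≤ Valued.v ϖ ^ (ℓ + ρ + 2 * t') ∧
          (Valued.v ((![α - 1, β - 1, 0] : Fin 3 → K) 2 - (![α - 1, β - 1, 0] : Fin 3 → K) 1) ≤ Valued.v ϖ ^ (ℓ + 2 * ρ + 2 * t') ∧
            Valued.v ((![α - 1, β - 1, 0] : Fin 3 → K) 2 - (![α - 1, β - 1, 0] : Fin 3 → K) 0) * Valued.v ϖ ^ (2 * t') ≤ Valued.v ϖ ^ (ℓ + 2 * ρ + 2 * t')))) ↔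
        ℓ + 2 * ρ + t' ≤ n₂) := by
  have hple : ∀ m n : ℕ, Valued.v ϖ ^ m ≤ Valued.v ϖ ^ n ↔ n ≤ m := fun m n => UnitaryLatticeTree.v_pow_le_v_pow_iff hϖ m n
  have hpeq : ∀ m n : ℕ, Valued.v ϖ ^ m = Valued.v ϖ ^ n ↔ m = n := fun m n =>
    ⟨fun h => le_antisymm ((hple n m).1 h.ge) ((hple m n).1 h.le), fun h => by rw [h]⟩
  have h₃' : Valued.v (β - 1 - (α - 1)) = Valued.v ϖ ^ n₃ := by rw [show β - 1 - (α - 1) = β - α by ring, Valuation.map_sub_swap, h₃]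
  simp only [Matrix.cons_val_zero, Matrix.cons_val_one, Matrix.cons_val_two, Matrix.tail_cons, Matrix.head_cons, zero_sub, Valuation.map_neg, map_zero,
    zero_le, and_true, h₁, h₂, h₃', ← pow_add, hple, Ne, hpeq]
  exact ⟨by omega, ⟨fun h => by omega, fun h => ⟨⟨by omega, by omega⟩, by omega, by omega, by omega, by omega⟩⟩⟩

end Reads

/-! ## §2  Glue foot: `D₁` on its locus, `D₂` off -/

section Heads

variable {K : Type} [Field K] [Valued K ℤᵐ⁰] [CompleteSpace K] [Fintype 𝓀[K]] {σ : K →+* K} {ϖ : K} {d t : ℕ} {α β : K} {N₀ n₁ n₂ n₃ : ℕ}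
  {T : GL (Fin 3) K}

open Classical in
/-- **HEAD — TWO-TOKEN κ-WEIGHTED G1 CELL AT THE LETTERS OF RECORD, GLUE FOOT** (`n₁ = n₂ + 2t′`, `ρ ≤ n₂ < 2ρ`; `D₁` at `ℓ₁` ON its locus and genuine, `D₂` at `ℓ₂`
OFF its locus; `E₁ = ℓ₁ + 2ρ + 2t′ − n₂ ≥ e₀ = 2ρ + 2t′ − n₂` — concentric balls, the token ball finer; `f₀` any `σ`-fixed glue witness at depth `E₁` when the bridge
inequality `ℓ₁ + 2ρ − n₂ ≤ n₂ − d + 1` holds): `Σᶠ_{M ∈ G1, D₁M ⊆ ϖ^{ℓ₁}M ∧ D₂M ⊆ ϖ^{ℓ₂}M} κᵢ(M)·w(M) =`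
`[ℓ₂ + 2ρ ≤ 2n₂] · [ℓ₁ + ρ ≤ n₂ ∧ ℓ₁ + 2ρ − n₂ ≤ n₂ − d + 1] · (ω(−1)ω(1+f₀)·[2d ≤ E₁+1], ω(−1)ω(f₀)ω(1+f₀)·[2d+2t′ ≤ E₁+1], ω(f₀)·[2d+2t′ ≤ E₁+1])ᵢ · q^{2ρ+2t′−⌈E₁∕2⌉}`.
[cite: Kottwitz1986BaseChangeUnits, §1 pp. 240–241] [cite: LanglandsShelstad1987, §3] [cite: Serre1979, Ch. V §3 Prop. 5, Cor. 3] [cite: Rogawski1990, §4.9 Prop. 4.9.1 (a)(b) p. 55] -/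
theorem finsum_kappaCount_mul_stabiliserWeight_stratum_G1_sep_levels_foot (hD : IsRamifiedQuadraticDatum σ ϖ d t) (h2 : Valued.v (2 : K) < 1)
    (hE : IsElementDatum σ ϖ N₀ α β n₁ n₂ n₃) (hN₀ : d ≤ N₀) (hT : (T : Matrix (Fin 3) (Fin 3) K) = Matrix.diagonal ![α, β, 1])
    (ρ t' : ℕ) (hρ : 1 ≤ ρ) (ht' : 1 ≤ t') (hfoot : n₁ = n₂ + 2 * t') (hρm : ρ ≤ n₂) (hm : n₂ < 2 * ρ) (i : Fin 3) (ℓ₁ ℓ₂ : ℕ)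
    (f₀ : K) (hσf₀ : σ f₀ = f₀)
    (hf₀ : ℓ₁ + 2 * ρ - n₂ ≤ n₂ - d + 1 → Valued.v (f₀ + (β - 1) / (α - 1)) ≤ Valued.v ϖ ^ (ℓ₁ + 2 * ρ + 2 * t' - n₂)) :
    ∑ᶠ M ∈ {M | M ∈ stratum σ ϖ T ![2 * ρ, 2 * ρ + 2 * t', 2 * ρ + 2 * t'] ∧
        (LatticeInLevel ϖ ℓ₁ (Matrix.diagonal ![α - 1, β - 1, 0]) M ∧ LatticeInLevel ϖ ℓ₂ (Matrix.diagonal ![(α - 1) * (α - 1), (β - 1) * (β - 1), 0]) M)},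
        (kappaCount σ ϖ 0 i M : ℚ) * stabiliserWeight σ M =
      if ℓ₂ + 2 * ρ ≤ 2 * n₂ then
        (if ℓ₁ + ρ ≤ n₂ ∧ ℓ₁ + 2 * ρ - n₂ ≤ n₂ - d + 1 then
            (![if 2 * d ≤ ℓ₁ + 2 * ρ + 2 * t' - n₂ + 1 then (normSign σ (-1 : K) : ℚ) * normSign σ (1 + f₀) else 0,
               if 2 * d + 2 * t' ≤ ℓ₁ + 2 * ρ + 2 * t' - n₂ + 1 then (normSign σ (-1 : K) : ℚ) * normSign σ f₀ * normSign σ (1 + f₀) else 0,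
               if 2 * d + 2 * t' ≤ ℓ₁ + 2 * ρ + 2 * t' - n₂ + 1 then (normSign σ f₀ : ℚ) else 0] : Fin 3 → ℚ) i *
              (Fintype.card 𝓀[K] : ℚ) ^ (2 * ρ + 2 * t' - (ℓ₁ + 2 * ρ + 2 * t' - n₂ + 1) / 2)
          else 0)
      else 0 := by
  classical
  obtain ⟨hσ, hvσ, hϖ, hfix, hd, hd1, -⟩ := id hD
  obtain ⟨hαn, hβn, -, hα1, hβ1, h₁, h₂, h₃, -, hN2, hN3⟩ := id hE
  obtain ⟨hϖ0, hϖ1⟩ := ne_zero_and_v_lt_one_of_v_eq_exp hϖ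
  have hvϖ0 : Valued.v ϖ ≠ 0 := (Valuation.ne_zero_iff _).2 hϖ0
  obtain ⟨hi1, hi2, -⟩ := isoceles_depths hϖ h₁ h₂ h₃
  have hn₃ : n₃ = n₂ := by
    rcases min_le_iff.1 hi1 with h | h <;> rcases min_le_iff.1 hi2 with h' | h' <;> omega
  obtain ⟨hk₁, hloc₁, hout₁⟩ := modelToken_data hϖ h₁ h₂ hfoot ℓ₁ ρ
  obtain ⟨hne₂, hread₂⟩ := sqToken_read_G1_iff hϖ h₁ h₂ hfoot ht' ℓ₂ ρ
  have hg₀ : Valued.v ((β - 1) / (α - 1)) = Valued.v ϖ ^ (2 * t') := v_glueUnit_eq hvϖ0 (hfoot ▸ h₁) h₂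
  have hαd : Valued.v (α - 1) ≤ Valued.v ϖ ^ d := by rw [h₂]; exact pow_le_pow_right_of_le_one' hϖ1.le (by omega)
  have hβd : Valued.v (β - 1) ≤ Valued.v ϖ ^ d := by rw [h₁]; exact pow_le_pow_right_of_le_one' hϖ1.le (by omega)
  have hbridge := exists_fixed_v_add_glueUnit_le_iff hσ hvσ hfix hϖ hd hd1 hαn hβn hα1 hβ1 hαd hβd h₃ (by omega) hg₀
    (show 2 * t' ≤ ℓ₁ + 2 * ρ + 2 * t' - n₂ by omega)
  rw [hn₃, show ℓ₁ + 2 * ρ + 2 * t' - n₂ - 2 * t' = ℓ₁ + 2 * ρ - n₂ by omega] at hbridge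
  rw [finsum_stratum_G1_sep_and_eq_of_ne_right hD T ρ (2 * t') hρ (by omega) ℓ₁ _ ℓ₂ _ hne₂, if_congr hread₂ rfl rfl]
  by_cases hr₂ : ℓ₂ + 2 * ρ ≤ 2 * n₂
  · rw [if_pos hr₂, if_pos hr₂]
    by_cases hwit : ℓ₁ + 2 * ρ - n₂ ≤ n₂ - d + 1
    · have hf := hf₀ hwit
      rw [finsum_kappaCount_mul_stabiliserWeight_stratum_G1_sep_onLocus_foot_of_witness hD h2 hE hT ρ t' hρ ht' hfoot hρm hm i ℓ₁ n₂ _ hk₁ hloc₁ (by omega)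
          hσf₀ (hf.trans (pow_le_pow_right_of_le_one' hϖ1.le (by omega))) (by rw [glueRatio_modelToken_eq]; exact hf),
        max_eq_right (show 2 * ρ + 2 * t' - n₂ ≤ ℓ₁ + 2 * ρ + 2 * t' - n₂ by omega)]
      simp only [hout₁]
      by_cases hℓ : ℓ₁ + ρ ≤ n₂
      · rw [if_pos hℓ, if_pos (And.intro hℓ hwit)]
      · rw [if_neg hℓ, if_neg (fun h => hℓ h.1)]
    · rw [if_neg (fun h => hwit h.2)]
      refine finsum_kappaCount_mul_stabiliserWeight_stratum_G1_sep_onLocus_foot_of_no_common_witness hD h2 hE hT ρ t' hρ ht' hfoot hρm hm i ℓ₁ n₂ _ hk₁ hloc₁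
        (by omega) ?_
      rw [glueRatio_modelToken_eq]
      rintro ⟨f, hσf, -, hf⟩
      exact hwit (hbridge.1 ⟨f, hσf, hf⟩)
  · rw [if_neg hr₂, if_neg hr₂]

/-! ## §3  Tube on the `D₁` locus `n₁ = n₂ + 2t′` -/

open Classical in
/-- **HEAD — TWO-TOKEN κ-WEIGHTED G1 CELL AT THE LETTERS OF RECORD, TUBE ON THE `D₁` LOCUS** (`n₁ = n₂ + 2t′`, `2ρ ≤ n₂`; `D₂` off its locus, read
`ℓ₂ + 2ρ ≤ 2n₂`; `D₁` vacuous iff `ℓ₁ + 2ρ ≤ n₂` — then ★ κG1's value verbatim — else genuine with `E₁ = ℓ₁ + 2ρ + 2t′ − n₂` and a fixed glue witness `f₀` at depth `E₁`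
iff `ℓ₁ + 2ρ − n₂ ≤ n₂ − d + 1`). [cite: Kottwitz1986BaseChangeUnits, §1 pp. 240–241] [cite: LanglandsShelstad1987, §3] [cite: Serre1979, Ch. V §3 Prop. 5, Cor. 3]
[cite: Rogawski1990, §4.9 Prop. 4.9.1 (a)(b) p. 55] -/
theorem finsum_kappaCount_mul_stabiliserWeight_stratum_G1_sep_levels_tube_locusOne (hD : IsRamifiedQuadraticDatum σ ϖ d t) (h2 : Valued.v (2 : K) < 1)
    (hE : IsElementDatum σ ϖ N₀ α β n₁ n₂ n₃) (hN₀ : d ≤ N₀) (hT : (T : Matrix (Fin 3) (Fin 3) K) = Matrix.diagonal ![α, β, 1])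
    (ρ t' : ℕ) (hρ : 1 ≤ ρ) (ht' : 1 ≤ t') (hloc : n₁ = n₂ + 2 * t') (htube : 2 * ρ ≤ n₂) (i : Fin 3) (ℓ₁ ℓ₂ : ℕ)
    (f₀ : K) (hσf₀ : σ f₀ = f₀)
    (hf₀ : ¬ ℓ₁ + 2 * ρ ≤ n₂ → ℓ₁ + 2 * ρ - n₂ ≤ n₂ - d + 1 → Valued.v (f₀ + (β - 1) / (α - 1)) ≤ Valued.v ϖ ^ (ℓ₁ + 2 * ρ + 2 * t' - n₂)) :
    ∑ᶠ M ∈ {M | M ∈ stratum σ ϖ T ![2 * ρ, 2 * ρ + 2 * t', 2 * ρ + 2 * t'] ∧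
        (LatticeInLevel ϖ ℓ₁ (Matrix.diagonal ![α - 1, β - 1, 0]) M ∧ LatticeInLevel ϖ ℓ₂ (Matrix.diagonal ![(α - 1) * (α - 1), (β - 1) * (β - 1), 0]) M)},
        (kappaCount σ ϖ 0 i M : ℚ) * stabiliserWeight σ M =
      if ℓ₂ + 2 * ρ ≤ 2 * n₂ then
        (if ℓ₁ + 2 * ρ ≤ n₂ then
            ((if 2 ∣ 2 * t' ∧ 2 * ρ ≤ min n₂ n₃ ∧ 2 * ρ + 2 * t' ≤ n₁ then
                (![(normSign σ (-1 : K) : ℚ) * (Fintype.card 𝓀[K] : ℚ) ^ (2 * ρ + 2 * t' / 2 - 1) *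
                    ((if 2 * d ≤ 2 * t' then (Fintype.card 𝓀[K] : ℚ) - 1 else 0) - (if 2 * t' + 2 = 2 * d then 1 else 0)), 0, 0] : Fin 3 → ℚ) i
              else 0) +
            (if 2 ∣ 2 * t' ∧ n₂ = n₃ ∧ n₁ = n₂ + 2 * t' ∧ n₂ < 2 * ρ ∧ 2 * ρ - n₂ ≤ n₂ - d + 1 then
                (![if 2 * d ≤ 2 * t' + 2 * ((2 * ρ - n₂ + 1) / 2) then (normSign σ (-1 : K) : ℚ) * normSign σ (1 + f₀) else 0,
                   if d ≤ (2 * ρ - n₂ + 1) / 2 then (normSign σ (-1 : K) : ℚ) * normSign σ f₀ * normSign σ (1 + f₀) else 0,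
                   if d ≤ (2 * ρ - n₂ + 1) / 2 then (normSign σ f₀ : ℚ) else 0] : Fin 3 → ℚ) i *
                  (Fintype.card 𝓀[K] : ℚ) ^ (2 * ρ + 2 * t' / 2 - (2 * ρ - n₂ + 1) / 2)
              else 0))
          else
            (if ℓ₁ + ρ ≤ n₂ ∧ ℓ₁ + 2 * ρ - n₂ ≤ n₂ - d + 1 then
                (![if 2 * d ≤ ℓ₁ + 2 * ρ + 2 * t' - n₂ + 1 then (normSign σ (-1 : K) : ℚ) * normSign σ (1 + f₀) else 0,
                   if 2 * d + 2 * t' ≤ ℓ₁ + 2 * ρ + 2 * t' - n₂ + 1 then (normSign σ (-1 : K) : ℚ) * normSign σ f₀ * normSign σ (1 + f₀) else 0,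
                   if 2 * d + 2 * t' ≤ ℓ₁ + 2 * ρ + 2 * t' - n₂ + 1 then (normSign σ f₀ : ℚ) else 0] : Fin 3 → ℚ) i *
                  (Fintype.card 𝓀[K] : ℚ) ^ (2 * ρ + 2 * t' - (ℓ₁ + 2 * ρ + 2 * t' - n₂ + 1) / 2)
              else 0))
      else 0 := by
  classical
  obtain ⟨hσ, hvσ, hϖ, hfix, hd, hd1, -⟩ := id hD
  obtain ⟨hαn, hβn, -, hα1, hβ1, h₁, h₂, h₃, -, hN2, hN3⟩ := id hE
  obtain ⟨hϖ0, hϖ1⟩ := ne_zero_and_v_lt_one_of_v_eq_exp hϖ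
  have hvϖ0 : Valued.v ϖ ≠ 0 := (Valuation.ne_zero_iff _).2 hϖ0
  obtain ⟨hi1, hi2, -⟩ := isoceles_depths hϖ h₁ h₂ h₃
  have hn₃ : n₃ = n₂ := by
    rcases min_le_iff.1 hi1 with h | h <;> rcases min_le_iff.1 hi2 with h' | h' <;> omega
  obtain ⟨hk₁, hloc₁, hout₁⟩ := modelToken_data hϖ h₁ h₂ hloc ℓ₁ ρ
  obtain ⟨hne₂, hread₂⟩ := sqToken_read_G1_iff hϖ h₁ h₂ hloc ht' ℓ₂ ρ
  have hg₀ : Valued.v ((β - 1) / (α - 1)) = Valued.v ϖ ^ (2 * t') := v_glueUnit_eq hvϖ0 (hloc ▸ h₁) h₂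
  have hαd : Valued.v (α - 1) ≤ Valued.v ϖ ^ d := by rw [h₂]; exact pow_le_pow_right_of_le_one' hϖ1.le (by omega)
  have hβd : Valued.v (β - 1) ≤ Valued.v ϖ ^ d := by rw [h₁]; exact pow_le_pow_right_of_le_one' hϖ1.le (by omega)
  rw [finsum_stratum_G1_sep_and_eq_of_ne_right hD T ρ (2 * t') hρ (by omega) ℓ₁ _ ℓ₂ _ hne₂, if_congr hread₂ rfl rfl]
  by_cases hr₂ : ℓ₂ + 2 * ρ ≤ 2 * n₂
  · rw [if_pos hr₂, if_pos hr₂]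
    by_cases hvac₁ : ℓ₁ + 2 * ρ ≤ n₂
    · rw [if_pos hvac₁]
      exact finsum_kappaCount_mul_stabiliserWeight_stratum_G1_sep_eq_of_vacuous hD h2 hE hN₀ hT ρ t' hρ ht' i f₀ hσf₀ (fun _ _ _ h _ => absurd h (by omega))
        ℓ₁ n₂ _ hk₁ hloc₁ (hout₁.2 (by omega)) hvac₁
    · rw [if_neg hvac₁]
      have hbridge := exists_fixed_v_add_glueUnit_le_iff hσ hvσ hfix hϖ hd hd1 hαn hβn hα1 hβ1 hαd hβd h₃ (by omega) hg₀
        (show 2 * t' ≤ ℓ₁ + 2 * ρ + 2 * t' - n₂ by omega)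
      rw [hn₃, show ℓ₁ + 2 * ρ + 2 * t' - n₂ - 2 * t' = ℓ₁ + 2 * ρ - n₂ by omega] at hbridge
      by_cases hwit : ℓ₁ + 2 * ρ - n₂ ≤ n₂ - d + 1
      · have hf := hf₀ hvac₁ hwit
        rw [finsum_kappaCount_mul_stabiliserWeight_stratum_G1_sep_onLocus_tube_of_witness hD h2 hE hT ρ t' hρ ht' ⟨by omega, htube⟩ i ℓ₁ n₂ _ hk₁ hloc₁ (by omega)
            hσf₀ (by rw [glueRatio_modelToken_eq]; exact hf)]
        simp only [hout₁]
        by_cases hℓ : ℓ₁ + ρ ≤ n₂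
        · rw [if_pos hℓ, if_pos (And.intro hℓ hwit)]
        · rw [if_neg hℓ, if_neg (fun h => hℓ h.1)]
      · rw [if_neg (fun h => hwit h.2)]
        refine finsum_kappaCount_mul_stabiliserWeight_stratum_G1_sep_onLocus_of_no_witness hD h2 hT ρ t' hρ ht' i ℓ₁ n₂ _ hk₁ hloc₁ (by omega) ?_
        rw [glueRatio_modelToken_eq]
        rintro ⟨f, hσf, hf⟩
        exact hwit (hbridge.1 ⟨f, hσf, hf⟩)
  · rw [if_neg hr₂, if_neg hr₂]

/-! ## §4  Tube on the `D₂` locus `n₁ = n₂ + t′` -/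

open Classical in
/-- **HEAD — TWO-TOKEN κ-WEIGHTED G1 CELL AT THE LETTERS OF RECORD, TUBE ON THE `D₂` LOCUS** (`n₁ = n₂ + t′`, `2ρ + 2t′ ≤ n₁`, `2ρ ≤ n₂`; level guard
`ℓ₂ ≤ 2ρ`): `D₁` is off its locus with read `ℓ₁ + 2ρ + t′ ≤ n₂` (§1), and the `D₂` cell is ★ κG1's value outright (K6 `…_G1_sep_sqToken_tube`), so
`Σᶠ_{M ∈ G1, D₁M ⊆ ϖ^{ℓ₁}M ∧ D₂M ⊆ ϖ^{ℓ₂}M} κᵢ(M)·w(M) = [ℓ₁ + 2ρ + t′ ≤ n₂] · (★ κG1 value)`. [cite: Kottwitz1986BaseChangeUnits, §1 pp. 240–241] [cite: LanglandsShelstad1987, §3]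
[cite: Rogawski1990, §4.9 Prop. 4.9.1 (a)(b) p. 55] -/
theorem finsum_kappaCount_mul_stabiliserWeight_stratum_G1_sep_levels_tube_locusTwo (hD : IsRamifiedQuadraticDatum σ ϖ d t) (h2 : Valued.v (2 : K) < 1)
    (hE : IsElementDatum σ ϖ N₀ α β n₁ n₂ n₃) (hN₀ : d ≤ N₀) (hT : (T : Matrix (Fin 3) (Fin 3) K) = Matrix.diagonal ![α, β, 1])
    (ρ t' : ℕ) (hρ : 1 ≤ ρ) (ht' : 1 ≤ t') (hloc : n₁ = n₂ + t') (htube : 2 * ρ + 2 * t' ≤ n₁ ∧ 2 * ρ ≤ n₂) (i : Fin 3) (ℓ₁ ℓ₂ : ℕ) (hℓ₂ : ℓ₂ ≤ 2 * ρ)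
    (f₀ : K) (hσf₀ : σ f₀ = f₀)
    (hglue : 2 ∣ 2 * t' → n₂ = n₃ → n₁ = n₂ + 2 * t' → n₂ < 2 * ρ → 2 * ρ - n₂ ≤ n₂ - d + 1 →
      Valued.v (f₀ + (β - 1) / (α - 1)) ≤ Valued.v ϖ ^ (2 * ρ + 2 * t' - n₂)) :
    ∑ᶠ M ∈ {M | M ∈ stratum σ ϖ T ![2 * ρ, 2 * ρ + 2 * t', 2 * ρ + 2 * t'] ∧
        (LatticeInLevel ϖ ℓ₁ (Matrix.diagonal ![α - 1, β - 1, 0]) M ∧ LatticeInLevel ϖ ℓ₂ (Matrix.diagonal ![(α - 1) * (α - 1), (β - 1) * (β - 1), 0]) M)},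
        (kappaCount σ ϖ 0 i M : ℚ) * stabiliserWeight σ M =
      if ℓ₁ + 2 * ρ + t' ≤ n₂ then
        ((if 2 ∣ 2 * t' ∧ 2 * ρ ≤ min n₂ n₃ ∧ 2 * ρ + 2 * t' ≤ n₁ then
            (![(normSign σ (-1 : K) : ℚ) * (Fintype.card 𝓀[K] : ℚ) ^ (2 * ρ + 2 * t' / 2 - 1) *
                ((if 2 * d ≤ 2 * t' then (Fintype.card 𝓀[K] : ℚ) - 1 else 0) - (if 2 * t' + 2 = 2 * d then 1 else 0)), 0, 0] : Fin 3 → ℚ) i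
          else 0) +
        (if 2 ∣ 2 * t' ∧ n₂ = n₃ ∧ n₁ = n₂ + 2 * t' ∧ n₂ < 2 * ρ ∧ 2 * ρ - n₂ ≤ n₂ - d + 1 then
            (![if 2 * d ≤ 2 * t' + 2 * ((2 * ρ - n₂ + 1) / 2) then (normSign σ (-1 : K) : ℚ) * normSign σ (1 + f₀) else 0,
               if d ≤ (2 * ρ - n₂ + 1) / 2 then (normSign σ (-1 : K) : ℚ) * normSign σ f₀ * normSign σ (1 + f₀) else 0,
               if d ≤ (2 * ρ - n₂ + 1) / 2 then (normSign σ f₀ : ℚ) else 0] : Fin 3 → ℚ) i *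
              (Fintype.card 𝓀[K] : ℚ) ^ (2 * ρ + 2 * t' / 2 - (2 * ρ - n₂ + 1) / 2)
          else 0))
      else 0 := by
  classical
  have hϖ : Valued.v ϖ = exp (-1 : ℤ) := hD.2.2.1
  obtain ⟨-, -, -, -, -, h₁, h₂, h₃, -, -, -⟩ := id hE
  obtain ⟨hi1, hi2, -⟩ := isoceles_depths hϖ h₁ h₂ h₃
  have hn₃ : n₃ = n₂ := by
    rcases min_le_iff.1 hi1 with h | h <;> rcases min_le_iff.1 hi2 with h' | h' <;> omega
  obtain ⟨hne₁, hread₁⟩ := modelToken_read_G1_iff hϖ h₁ h₂ h₃ hloc hn₃ ht' ℓ₁ ρ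
  rw [finsum_stratum_G1_sep_and_eq_of_ne_left hD T ρ (2 * t') hρ (by omega) ℓ₁ _ hne₁ ℓ₂ _, if_congr hread₁ rfl rfl]
  by_cases hr₁ : ℓ₁ + 2 * ρ + t' ≤ n₂
  · rw [if_pos hr₁, if_pos hr₁]
    exact finsum_kappaCount_mul_stabiliserWeight_stratum_G1_sep_sqToken_tube hD h2 hE hN₀ hT ρ t' hρ ht' hloc htube i f₀ hσf₀ hglue ℓ₂ hℓ₂
  · rw [if_neg hr₁, if_neg hr₁]

end Heads

end Summit.HodgeConjecture.HodgeConjecture.Cruxes.H413.F0P3cDyRamLabelledKappaTwoTokenGlued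

end
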